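import Mathlib
import Summits.ValiantsHypothesis.ValiantsHypothesis.Theorems.GeneratorObstructionsPowGenDegreeQPWideAtoms
import Literature.Computability.AlgebraicComplexity.BI17FormPolystabilityCriterion

/-!
# Route GeneratorObstructions — crux K2 `PowGenDegreeQP` (stmt-ValiantsHypothesis-11655), line
# `trace-side-regimes`: UNCONDITIONAL wide generator types at inner degree `m = 2`, and the
# uniform-exponent strengthening of K2 is FALSE

Helper file (`--supports stmt-ValiantsHypothesis-11655`), continuing
`GeneratorObstructionsPowGenDegreeQPWideAtoms` (least occurring constant weight of
`ℂ[Δ_m[tr X_{m+e}^m]]`, when one occurs, is a WIDE generator type of size `k₀ (m+e)²`).  Here the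
occurrence hypothesis is DISCHARGED at inner degree `m = 2`, for every matrix size `n`:

1. `powTrace_two_eq`, `coeff_powTrace_two`, `mem_support_powTrace_two` — `tr X_n² = ∑_{p} x_p x_{pᵀ}`,
   its coefficients and support (`{e_p + e_{pᵀ}}`);
2. `isPolystable_powTrace_two` — **`tr X_n²` is polystable for every `n`** by the corrected BI 2017
   Prop. 2.8 criterion (tree `isPolystable_of_rigid_of_posCone`): the support is RIGID (two letters
   `p, q` form a monomial of `tr X²` iff `q = pᵀ`) and `(1,…,1) = ∑_α (#fibre(α)/2) · α` with all
   coefficients positive.  (For `n = m = 2` this is also the tree's MS2001 §4.1 Remark; the point here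
   is ALL `n`, i.e. the nondegenerate quadric `tr X_n²` in `n²` letters.)
3. `powFormLex_two_exists_hasHighestWeight_const` — hence some constant weight `-k·𝟙` (`k > 0`)
   OCCURS in `ℂ[Δ_2[tr X_n²]]` (Hilbert's nonvanishing invariant at a closed orbit, tree
   `exists_hasHighestWeight_const_of_isPolystable`, transported `Fin (n·n) → MatIdx n` as for `per`).
4. `exists_wide_genType_two` — **unconditionally**, for every `e ≥ 1` the covariant algebra of
   `Δ_2[tr X_{2+e}²]` has a WIDE generator type (all `(2+e)²` entries nonzero, `γ ≠ 0`) of size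
   `k₀ (2+e)²` with `k₀ ≥ 2`: the wide regime of `stub_wideGen` is NON-VACUOUS in every window
   `c ≥ 1`, with generator degrees `≥ (2+e)²` growing to the top of the window.
5. `not_uniform_powGenDegreeQP`, `not_uniform_wideGen` — consequently the strengthenings of K2 and of
   `stub_wideGen` with the exponent `c₀` INDEPENDENT of the window exponent `c` (`∃ c₀ ∀ c …`) are
   FALSE: at `m = 2` the bound `2 · 2^((1 + c₀)^c₀)` is a constant while wide generator degrees
   `≥ (2+e)²` are unbounded across windows.  The registered quantifier order `∀ c ∃ c₀` is essential.

Honest framing: the quadric `m = 2` is the degenerate bottom of the family; this calibrates the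
statement (non-vacuity, quantifier order) and proves nothing toward `stub_wideGen`/K2 at `m ≥ 3`,
which remain OPEN; `VP ≠ VNP` is not touched.

References: Bürgisser–Ikenmeyer, J. Algebra 477 (2017) §2.2 Prop. 2.8 (corrected, Derksen–Makam
2022 Lemma 3.1), Cor. 2.9, §3.3; Mulmuley–Sohoni, SIAM J. Comput. 31 (2001) §4.1.
-/

namespace Summit.ValiantsHypothesis.ValiantsHypothesis.Theorems.GeneratorObstructions.PowGenDegreeQP

open MvPolynomial
open Literature.NumberTheory.DiophantineGeometry Literature.Computability.AlgebraicComplexity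
open Summit.ValiantsHypothesis.ValiantsHypothesis.Theses.GeneratorObstructions
open Summit.ValiantsHypothesis.ValiantsHypothesis.Theorems.GenInheritance
open Summit.ValiantsHypothesis.ValiantsHypothesis.Theorems.GeneratorObstructions.SliceTransfer
open Summit.ValiantsHypothesis.ValiantsHypothesis.Theorems.GeneratorObstructions.PerGenDegreeSuperQP

-- `Summit.ValiantsHypothesis.ValiantsHypothesis.…` is the tree's mandated single-conjunct layout.
set_option linter.dupNamespace false

noncomputable section

/-! ## 1. The quadratic power trace: monomials, coefficients, support -/

section Quadric

variable (n : ℕ)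

/-- `tr X_n² = ∑_{p = (i,j)} x_{ij} x_{ji}`. [folklore] -/
theorem powTrace_two_eq :
    powTrace ℂ n 2 = ∑ p : Fin n × Fin n, (X p * X p.swap : MvPolynomial (Fin n × Fin n) ℂ) := by
  unfold powTrace
  rw [pow_two, Matrix.trace, Fintype.sum_prod_type]
  refine Finset.sum_congr rfl fun i _ => ?_
  rw [Matrix.diag_apply, Matrix.mul_apply]
  refine Finset.sum_congr rfl fun j _ => ?_
  simp [Matrix.mvPolynomialX_apply]

/-- The exponent `e_p + e_{pᵀ}` of the monomial `x_p x_{pᵀ}`. -/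
private theorem X_mul_X_swap_eq (p : Fin n × Fin n) :
    (X p * X p.swap : MvPolynomial (Fin n × Fin n) ℂ) =
      monomial (Finsupp.single p 1 + Finsupp.single p.swap 1) 1 := by
  rw [X, X, monomial_mul, mul_one]

/-- The coefficient of `tr X_n²` at an exponent `α` is the number of letters `p` with
`α = e_p + e_{pᵀ}` (`1` on squares `x_{ii}²`, `2` on `x_{ij} x_{ji}`, `0` elsewhere). [folklore] -/
theorem coeff_powTrace_two (α : Fin n × Fin n →₀ ℕ) :
    coeff α (powTrace ℂ n 2) =
      ((Finset.univ.filter fun p : Fin n × Fin n =>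
        Finsupp.single p 1 + Finsupp.single p.swap 1 = α).card : ℂ) := by
  classical
  rw [powTrace_two_eq, coeff_sum]
  simp_rw [X_mul_X_swap_eq, coeff_monomial]
  rw [Finset.sum_boole]

/-- The support of `tr X_n²` is `{e_p + e_{pᵀ}}`. [folklore] -/
theorem mem_support_powTrace_two (α : Fin n × Fin n →₀ ℕ) :
    α ∈ (powTrace ℂ n 2).support ↔
      ∃ p : Fin n × Fin n, Finsupp.single p 1 + Finsupp.single p.swap 1 = α := by
  classical
  rw [mem_support_iff, coeff_powTrace_two, Nat.cast_ne_zero, Ne, Finset.card_eq_zero,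
    ← Ne, ← Finset.nonempty_iff_ne_empty]
  constructor
  · rintro ⟨p, hp⟩
    exact ⟨p, (Finset.mem_filter.mp hp).2⟩
  · rintro ⟨p, hp⟩
    exact ⟨p, Finset.mem_filter.mpr ⟨Finset.mem_univ _, hp⟩⟩

/-- Two-letter words in the support: `e_a + e_b = e_p + e_{pᵀ}` forces `b = aᵀ`. [folklore] -/
theorem eq_swap_of_single_add_single_eq {a b p : Fin n × Fin n}
    (h : Finsupp.single p 1 + Finsupp.single p.swap 1 = Finsupp.single a 1 + Finsupp.single b 1) :
    b = a.swap := by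
  rcases (Finsupp.single_add_single_eq_single_add_single one_ne_zero one_ne_zero).mp h with
    ⟨h1, h2⟩ | ⟨-, h1, h2⟩ | ⟨h0, -, -⟩
  · rw [← h2, ← h1]
  · rw [← h1, ← h2, Prod.swap_swap]
  · exact absurd h0 (by norm_num)

/-- `tr X_n²` is a form of degree `2`. [folklore] -/
theorem powTrace_two_isHomogeneous : (powTrace ℂ n 2).IsHomogeneous 2 := by
  rw [powTrace_two_eq]
  exact IsHomogeneous.sum _ _ _ fun p _ => (isHomogeneous_X ℂ p).mul (isHomogeneous_X ℂ p.swap)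

/-- **`tr X_n²` is polystable, for every `n`** — corrected BI 2017 Prop. 2.8 (tree
`isPolystable_of_rigid_of_posCone`): rigid support (`eq_swap_of_single_add_single_eq`) and
`(1,…,1) = ∑_α (#{p : α = e_p + e_{pᵀ}}/2) · α` with positive coefficients on the support.
[cite: BurgisserIkenmeyer2017, Prop. 2.8 (corrected) and Cor. 2.9] -/
theorem isPolystable_powTrace_two : IsPolystable (powTrace ℂ n 2) := by
  classical
  set g : Fin n × Fin n → (Fin n × Fin n →₀ ℕ) :=
    fun p => Finsupp.single p 1 + Finsupp.single p.swap 1 with hg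
  refine isPolystable_of_rigid_of_posCone (powTrace ℂ n 2) (powTrace_two_isHomogeneous n) ?_
    (fun α => ((Finset.univ.filter fun p : Fin n × Fin n => g p = α).card : ℚ) / 2) ?_ ?_
  · -- rigidity
    intro j k b hj hjb
    have hsupp : ∀ w : Fin 2 → Fin n × Fin n, coeff (tcontent w) (powTrace ℂ n 2) ≠ 0 →
        w 1 = (w 0).swap := by
      intro w hw
      have hmem : tcontent w ∈ (powTrace ℂ n 2).support := mem_support_iff.mpr hw
      obtain ⟨p, hp⟩ := (mem_support_powTrace_two n _).mp hmem
      unfold tcontent at hp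
      rw [Fin.sum_univ_two] at hp
      exact eq_swap_of_single_add_single_eq n hp
    have h1 := hsupp j hj
    have h2 := hsupp (Function.update j k b) hjb
    have hk : k = 0 ∨ k = 1 := by
      match k with
      | ⟨0, _⟩ => exact Or.inl rfl
      | ⟨1, _⟩ => exact Or.inr rfl
      | ⟨i + 2, hi⟩ => exact absurd hi (by omega)
    rcases hk with rfl | rfl
    · rw [Function.update_of_ne (show (1 : Fin 2) ≠ 0 by decide), Function.update_self] at h2
      -- `j 1 = b.swap` and `j 1 = (j 0).swap`
      exact Prod.swap_injective (h2.symm.trans h1)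
    · rw [Function.update_self, Function.update_of_ne (show (0 : Fin 2) ≠ 1 by decide)] at h2
      exact h2.trans h1.symm
  · -- positivity on the support
    intro α hα
    obtain ⟨p, hp⟩ := (mem_support_powTrace_two n α).mp hα
    have hcard : 0 < (Finset.univ.filter fun q : Fin n × Fin n => g q = α).card :=
      Finset.card_pos.mpr ⟨p, Finset.mem_filter.mpr ⟨Finset.mem_univ _, hp⟩⟩
    positivity
  · -- the cone identity
    intro i
    have hfib : ∀ α ∈ (powTrace ℂ n 2).support,
        ((Finset.univ.filter fun q : Fin n × Fin n => g q = α).card : ℚ) / 2 * (α i : ℚ) =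
          ∑ q ∈ Finset.univ.filter (fun q : Fin n × Fin n => g q = α), ((g q i : ℕ) : ℚ) / 2 := by
      intro α _
      rw [Finset.sum_congr rfl fun q hq => by rw [(Finset.mem_filter.mp hq).2], Finset.sum_const,
        nsmul_eq_mul]
      ring
    rw [Finset.sum_congr rfl hfib,
      Finset.sum_fiberwise_of_maps_to (g := g) (fun q _ =>
        (mem_support_powTrace_two n (g q)).mpr ⟨q, rfl⟩)]
    -- `∑_q (e_q + e_{qᵀ})(i) / 2 = (1 + 1)/2`
    have hval : ∀ q : Fin n × Fin n,
        ((g q i : ℕ) : ℚ) = (if q = i then 1 else 0) + (if q = i.swap then 1 else 0) := by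
      intro q
      simp only [hg, Finsupp.coe_add, Pi.add_apply, Finsupp.single_apply]
      have hsw : (q.swap = i) = (q = i.swap) := by
        apply propext
        constructor
        · rintro rfl; rw [Prod.swap_swap]
        · rintro rfl; rw [Prod.swap_swap]
      simp only [hsw]
      push_cast
      rfl
    simp_rw [← Finset.sum_div, hval, Finset.sum_add_distrib, Finset.sum_ite_eq', Finset.mem_univ,
      if_true]
    norm_num

end Quadric

/-! ## 2. An occurring constant weight for `tr X_n²`, in the lexicographic matrix letters -/

section ConstWeight

variable {n : ℕ}

/-- `tr X_n²` numbered by `Fin (n·n)` and then placed lexicographically is `powFormLex ℂ n 2`.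
[folklore] -/
theorem rename_powTraceFin_eq (n : ℕ) :
    rename (fun i : Fin (n * n) => (toLex (finProdFinEquiv.symm i) : MatIdx n))
        (rename (finProdFinEquiv : Fin n × Fin n ≃ Fin (n * n)) (powTrace ℂ n 2)) =
      powFormLex ℂ n 2 := by
  have h : ((fun i : Fin (n * n) => (toLex (finProdFinEquiv.symm i) : MatIdx n)) ∘
      (finProdFinEquiv : Fin n × Fin n ≃ Fin (n * n)) : Fin n × Fin n → MatIdx n) = toLex := by
    funext ij
    simp only [Function.comp_apply, Equiv.symm_apply_apply]
  rw [rename_rename, h]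
  rfl

/-- **`tr X_n²` has an occurring constant weight** (`n ≥ 1`): some `-k·𝟙`, `k ≥ 1`, occurs in
`ℂ[Δ_2[tr X_n²]]` (lexicographic matrix letters) — polystability (`isPolystable_powTrace_two`),
Hilbert's nonvanishing invariant (tree `exists_hasHighestWeight_const_of_isPolystable`), and
transport of occurrence along the placement `Fin (n·n) → MatIdx n` (tree
`hasHighestWeight_orbitCoordRep_rename_dualOfPartition_iff`), as for the permanent.
[cite: BurgisserIkenmeyer2017, Def. 3.3 and Rem. 3.13] -/
theorem powFormLex_two_exists_hasHighestWeight_const (hn : 1 ≤ n) :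
    ∃ k : ℕ, 0 < k ∧
      highestWeightSpace (orbitCoordRep (powFormLex ℂ n 2) 2) (fun _ : MatIdx n => -(k : ℤ)) ≠ ⊥ := by
  classical
  set e : Fin n × Fin n ≃ Fin (n * n) := finProdFinEquiv with he
  set p : MvPolynomial (Fin (n * n)) ℂ := rename e (powTrace ℂ n 2) with hpdef
  have hp : p.IsHomogeneous 2 := (powTrace_two_isHomogeneous n).rename_isHomogeneous
  have hp0 : p ≠ 0 := by
    intro h
    have hinj := rename_injective (R := ℂ) (e : Fin n × Fin n → Fin (n * n)) e.injective
    have h0 : powTrace ℂ n 2 = 0 := hinj (by rw [← hpdef, h, map_zero])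
    apply powFormLex_ne_zero hn 2
    unfold powFormLex
    rw [h0, map_zero]
  have hps : IsPolystable p := (isPolystable_powTrace_two n).rename_equiv e
  have hN : 0 < n * n := Nat.mul_pos hn hn
  obtain ⟨k, hk, hHW⟩ := exists_hasHighestWeight_const_of_isPolystable hN two_ne_zero hp hp0 hps
  refine ⟨k, hk, ?_⟩
  set κ : Fin (n * n) → MatIdx n := fun i => toLex (e.symm i) with hκ
  have hκinj : Function.Injective κ := fun i j hij => e.symm.injective (toLex.injective hij)
  have key := hasHighestWeight_orbitCoordRep_rename_dualOfPartition_iff (k := ℂ) (m := 2)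
    (matIdxEquiv n) κ hκinj p two_ne_zero (Nat.Partition.rectangle (n * n) k)
    (Nat.Partition.card_parts_rectangle_le (n * n) k)
  rw [dualOfPartition_rectangle_self, hκ, hpdef, he, rename_powTraceFin_eq n] at key
  exact key.mpr hHW

end ConstWeight

/-! ## 3. Unconditional wide generator types at `m = 2`; the uniform strengthening of K2 is false -/

section Uniform

/-- **Wide generator types exist, unconditionally, at inner degree `2`.** For every `e ≥ 1` and
final segment `ι : MatIdx 2 → MatIdx (2 + e)` the covariant algebra of `Δ_2[tr X_{2+e}²]` has a wide
generator type: the least occurring constant weight `-k₀·𝟙`, with `γ ≠ 0`, `2 ≤ k₀`, and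
`-|χ| = k₀ (2+e)²`. [cite: BurgisserIkenmeyer2017, §3.3] -/
theorem exists_wide_genType_two {e : ℕ} (he : 1 ≤ e) (ι : MatIdx 2 → MatIdx (2 + e)) :
    ∃ k₀ : ℕ, 2 ≤ k₀ ∧
      (∃ x, x ∉ Set.range ι ∧ (fun _ : MatIdx (2 + e) => -(k₀ : ℤ)) x ≠ 0) ∧
      Module.finrank ℂ (↥(highestWeightSpace (orbitCoordRep (powFormLex ℂ (2 + e) 2) 2) (fun _ => -(k₀ : ℤ))) ⧸
        Submodule.comap (highestWeightSpace (orbitCoordRep (powFormLex ℂ (2 + e) 2) 2) (fun _ => -(k₀ : ℤ))).subtype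
          (⨆ p : Weight (MatIdx (2 + e)) × Weight (MatIdx (2 + e)),
            ⨆ (_ : p.1 + p.2 = (fun _ => -(k₀ : ℤ)) ∧ p.1 ≠ 0 ∧ p.2 ≠ 0),
            highestWeightSpace (orbitCoordRep (powFormLex ℂ (2 + e) 2) 2) p.1 *
              highestWeightSpace (orbitCoordRep (powFormLex ℂ (2 + e) 2) 2) p.2)) ≠ 0 ∧
      -(Weight.size (fun _ : MatIdx (2 + e) => -(k₀ : ℤ))) = (k₀ : ℤ) * (((2 + e) * (2 + e) : ℕ) : ℤ) := by
  obtain ⟨k₀, hk₀pos, hocc, -, hwide, hγ, hsize⟩ :=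
    exists_wide_genType_of_hasHighestWeight_const (m := 2) (e := e) (ι := ι) (by norm_num) he
      (powFormLex_two_exists_hasHighestWeight_const (n := 2 + e) (by omega))
  exact ⟨k₀, le_of_hasHighestWeight_const (m := 2) (e := e) (by norm_num) hk₀pos hocc, hwide, hγ, hsize⟩

/-- `Nat.log 2 2 = 1`. [folklore] -/
private theorem log_two_two : Nat.log 2 2 = 1 := by
  rw [Nat.log_eq_one_iff]
  norm_num

/-- Every `e` lies in some window at `m = 2`: `2 + e ≤ 2^((log₂ 2 + c)^c)` for `c = 2 + e`.
[folklore] -/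
private theorem window_two (e : ℕ) : 2 + e ≤ 2 ^ ((Nat.log 2 2 + (2 + e)) ^ (2 + e)) := by
  rw [log_two_two]
  have h1 : 2 + e < 2 ^ (2 + e) := Nat.lt_two_pow_self
  have h2 : 2 + e ≤ (1 + (2 + e)) ^ (2 + e) :=
    le_trans (by omega) (Nat.le_self_pow (by omega : 2 + e ≠ 0) (1 + (2 + e)))
  exact h1.le.trans (Nat.pow_le_pow_right two_pos h2)

/-- **The uniform-exponent strengthening of K2 is FALSE.**  With `c₀` chosen BEFORE the window
exponent `c` (`∃ c₀ ∀ c`, instead of the registered `∀ c ∃ c₀`), `PowGenDegreeQP` fails: at `m = 2`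
the bound `2 · 2^((1 + c₀)^c₀)` is constant, while for `e = 2^((1+c₀)^c₀)` the window `c = 2 + e`
contains `n = 2 + e` and `Δ_2[tr X_n²]` has a (wide) generator type of degree `k₀ n²/2 ≥ n² > 2^((1+c₀)^c₀)`
(`exists_wide_genType_two`). So the dependence `c ↦ c₀` in K2 is essential. [cite: BurgisserIkenmeyer2017, §3.3] -/
theorem not_uniform_powGenDegreeQP :
    ¬ ∃ c₀ : ℕ, ∀ c : ℕ, ∀ m e : ℕ, 1 ≤ m → m + e ≤ 2 ^ ((Nat.log 2 m + c) ^ c) →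
      ∀ χ : Weight (MatIdx (m + e)),
        Module.finrank ℂ (↥(highestWeightSpace (orbitCoordRep (powFormLex ℂ (m + e) m) m) χ) ⧸ Submodule.comap (highestWeightSpace (orbitCoordRep (powFormLex ℂ (m + e) m) m) χ).subtype (⨆ p : Weight (MatIdx (m + e)) × Weight (MatIdx (m + e)), ⨆ (_ : p.1 + p.2 = χ ∧ p.1 ≠ 0 ∧ p.2 ≠ 0), highestWeightSpace (orbitCoordRep (powFormLex ℂ (m + e) m) m) p.1 * highestWeightSpace (orbitCoordRep (powFormLex ℂ (m + e) m) m) p.2)) ≠ 0 →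
          -(Weight.size χ) ≤ (m : ℤ) * 2 ^ ((Nat.log 2 m + c₀) ^ c₀) := by
  rintro ⟨c₀, h⟩
  set B : ℕ := 2 ^ ((1 + c₀) ^ c₀) with hB
  obtain ⟨ι, -, -⟩ := exists_finalSegment (n := 2) (n' := 2 + B) (Nat.le_add_right 2 B)
  have hBpos : 1 ≤ B := Nat.one_le_two_pow
  obtain ⟨k₀, hk₀, -, hγ, hsize⟩ := exists_wide_genType_two (e := B) hBpos ι
  have hbound := h (2 + B) 2 B (by norm_num) (window_two B) _ hγ
  rw [hsize, log_two_two] at hbound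
  -- `k₀ (2+B)² ≤ 2 · B` is absurd for `k₀ ≥ 2`, `B ≥ 1`
  have hB' : ((2 : ℕ) : ℤ) * 2 ^ ((1 + c₀) ^ c₀) = 2 * (B : ℤ) := by rw [hB]; push_cast; ring
  rw [hB'] at hbound
  have hk : (2 : ℤ) ≤ k₀ := by exact_mod_cast hk₀
  have hsq : ((2 + B) * (2 + B) : ℕ) = ((2 + (B : ℤ)) * (2 + B) : ℤ) := by push_cast; ring
  rw [hsq] at hbound
  nlinarith

/-- **The uniform-exponent strengthening of `stub_wideGen` is FALSE** (same witness: the wide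
generator type of `Δ_2[tr X_{2+e}²]` at the least occurring constant weight), so in the registered
stub, too, `c₀` must depend on `c`. [cite: BurgisserIkenmeyer2017, §3.3] -/
theorem not_uniform_wideGen :
    ¬ ∃ c₀ : ℕ, ∀ c : ℕ, ∀ m e : ℕ, 1 ≤ m → m + e ≤ 2 ^ ((Nat.log 2 m + c) ^ c) →
      ∀ ι : MatIdx m → MatIdx (m + e), StrictMono ι → IsUpperSet (Set.range ι) →
        ∀ χ : Weight (MatIdx (m + e)), (∃ x, x ∉ Set.range ι ∧ χ x ≠ 0) →
          Module.finrank ℂ (↥(highestWeightSpace (orbitCoordRep (powFormLex ℂ (m + e) m) m) (χ)) ⧸ Submodule.comap (highestWeightSpace (orbitCoordRep (powFormLex ℂ (m + e) m) m) (χ)).subtype (⨆ p : Weight (MatIdx (m + e)) × Weight (MatIdx (m + e)), ⨆ (_ : p.1 + p.2 = (χ) ∧ p.1 ≠ 0 ∧ p.2 ≠ 0), highestWeightSpace (orbitCoordRep (powFormLex ℂ (m + e) m) m) p.1 * highestWeightSpace (orbitCoordRep (powFormLex ℂ (m + e) m) m) p.2)) ≠ 0 →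
            -(Weight.size χ) ≤ (m : ℤ) * 2 ^ ((Nat.log 2 m + c₀) ^ c₀) := by
  rintro ⟨c₀, h⟩
  set B : ℕ := 2 ^ ((1 + c₀) ^ c₀) with hB
  obtain ⟨ι, hι, hup⟩ := exists_finalSegment (n := 2) (n' := 2 + B) (Nat.le_add_right 2 B)
  have hBpos : 1 ≤ B := Nat.one_le_two_pow
  obtain ⟨k₀, hk₀, hwide, hγ, hsize⟩ := exists_wide_genType_two (e := B) hBpos ι
  have hbound := h (2 + B) 2 B (by norm_num) (window_two B) ι hι hup _ hwide hγ
  rw [hsize, log_two_two] at hbound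
  have hB' : ((2 : ℕ) : ℤ) * 2 ^ ((1 + c₀) ^ c₀) = 2 * (B : ℤ) := by rw [hB]; push_cast; ring
  rw [hB'] at hbound
  have hk : (2 : ℤ) ≤ k₀ := by exact_mod_cast hk₀
  have hsq : ((2 + B) * (2 + B) : ℕ) = ((2 + (B : ℤ)) * (2 + B) : ℤ) := by push_cast; ring
  rw [hsq] at hbound
  nlinarith

end Uniform

end

end Summit.ValiantsHypothesis.ValiantsHypothesis.Theorems.GeneratorObstructions.PowGenDegreeQP
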